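import Literature.Analysis.FluidPDE.VectorCalculus
import Literature.Analysis.FluidPDE.TaoAveragedSlotSobolev
import Literature.Analysis.FluidPDE.TaoAveragedCascadeReduction
import HarnessLib

/-!
# Tao 2016, §3.8–§3.9: rotations about an axis, the trigonometric polynomial `Θ`, its Fourier
coefficients `c_σ`, the non-degeneracy condition (3.24), and Fourier inversion on `(ℝ/2πℤ)³`

T. Tao, *Finite time blowup for an averaged three-dimensional Navier–Stokes equation*,
J. Amer. Math. Soc. **29** (2016), 601–674 = arXiv:1402.0290v3 (held as `paper:arxiv-1402.0290`;
equation and page numbers are those of that text), §3.7 (footnote 6, p. 19), §3.8 (pp. 19–20,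
(3.21)–(3.23)) and §3.9 (p. 20, (3.24) and the displays around it).

This is the algebraic and elementary-analytic core of the last two steps of the proof of
Theorem 3.2 (the ninth step is where "we finally need to use the precise form of `Λ`"), proved
here over concrete `ℝ³` so that any formalisation of §3.6–§3.8 can invoke it:

* `rodRot ξ θ` — **the rotation `R_ξ^θ` by the angle `θ` about the axis `ξ`** (right-hand rule,
  footnote 6: `R_ξ^θ X = (X·u)u + cos θ (X − (X·u)u) + sin θ (u × X)`, `u = ξ/|ξ|`), with
  `rodRot_of_inner_eq_zero` (on `ξ^⊥` it is `cos θ X + sin θ u × X`), `rodRot_axis`, linearity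
  and `norm_rodRot` (an isometry);
* `realΛ` and `Λ_complexify` — the real trilinear symbol (1.4) and its agreement with the tree's
  complex `Λ` on complexified vectors;
* `thetaFn η n γ` — **Tao's `Θ_{η₁,η₂,η₃}(γ₁,γ₂,γ₃) = Λ_{η}(R_{η₁}^{γ₁} n, R_{η₂}^{γ₂} n, R_{η₃}^{γ₃} n)`
  (3.22)** for a unit normal `n` of the (coplanar) `ηⱼ`, and `thetaFn_expand` — the expansion of
  the first two displays of §3.9;
* `cSigma η n σ` — **the Fourier coefficients `c_{σ₁,σ₂,σ₃}(η)`** (display before "But by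
  (3.17)", p. 20) and `thetaFn_eq_sum_cSigma` — **`Θ_η(γ) = Σ_{σ∈{±1}³} c_σ e^{i σ·γ}`**, i.e.
  `Θ` is a trigonometric polynomial of degree `(1,1,1)` ("cdoc");
* `cSigma_xi0`, `norm_cSigma_xi0_ge`, `cSigma_xi0_ne_zero` — **the non-degeneracy (3.24) at the
  normalised configuration (3.7)** (`ξ⁰` = the tree's `xi0`, `n = (0,0,1)`):
  `c_σ(ξ⁰) = (1/8i)(-σ₁ + σ₂/√2 - σ₁σ₂σ₃/√2)`, of modulus `≥ (√2-1)/8`;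
* `cSigma_ne_zero_near_xi0` — **(3.24) for all `η` within some `δ > 0` of `ξ⁰`** and all unit
  normals `n` on the side of `(0,0,1)` (Tao's "`+ O(ε₀)`", by compactness and continuity);
* `exp_eq_integral_thetaFn` — **Fourier inversion on `(ℝ/2πℤ)³`, the representation (3.23)**:
  `e^{iσ·α} = ∫_{(0,2π]³} F_σ(θ) Θ_η(θ+α) dθ` with `F_σ(θ) = e^{-iσ·θ}/((2π)³ c_σ(η))` whenever
  `c_σ(η) ≠ 0`.

Remark on the source: inserting the four values listed before the last display of §3.9 into
the source's own formula for `c_σ` gives `(1/8i)(-σ₁ + σ₂/√2 - σ₁σ₂σ₃/√2)`, which is the printed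
`-(1/8i)(-σ₁ + σ₂/√2 + σ₁σ₂σ₃/√2)` after `(σ₁,σ₂) ↦ (-σ₁,-σ₂)`; the set of the eight values, and
hence the non-degeneracy, is the same (`cSigma_xi0` records the computed form).

## References

* T. Tao, J. Amer. Math. Soc. 29 (2016), 601–674, arXiv:1402.0290v3, (1.4); §3.2 (3.7); §3.7
  footnote 6 p. 19; §3.8 (3.21)–(3.23) pp. 19–20; §3.9 (3.24) p. 20. Key `Tao2016AveragedNS`.
-/

noncomputable section

open Real Matrix MeasureTheory
open scoped RealInnerProductSpace

namespace Literature.Analysis.FluidPDE.Tao2016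

/-- Local notation for physical / frequency space `ℝ³`. -/
local notation "ℝ³" => EuclideanSpace ℝ (Fin 3)

/-! ### The real trilinear symbol `Λ` (1.4) on real vectors -/

/-- Tao's trilinear symbol (1.4) on **real** vectors,
`Λ_{ξ₁,ξ₂,ξ₃}(X₁,X₂,X₃) = (X₁ · ξ₂)(X₂ · X₃) + (X₂ · ξ₁)(X₁ · X₃)` (the tree's `Λ` is its
complex-bilinear extension to `ℂ³`, see `Λ_complexify`). [cite: Tao2016AveragedNS, (1.4)] -/
def realΛ (ξ₁ ξ₂ X₁ X₂ X₃ : ℝ³) : ℝ :=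
  ⟪X₁, ξ₂⟫ * ⟪X₂, X₃⟫ + ⟪X₂, ξ₁⟫ * ⟪X₁, X₃⟫

/-- The tree's complex `Λ` restricted to complexified real vectors is `realΛ`. [cite: Tao2016AveragedNS, (1.4)] -/
theorem Λ_complexify (ξ₁ ξ₂ X₁ X₂ X₃ : ℝ³) :
    Λ ξ₁ ξ₂ (FunctionSpaces.EuclideanSpace.complexify X₁) (FunctionSpaces.EuclideanSpace.complexify X₂)
        (FunctionSpaces.EuclideanSpace.complexify X₃) = (realΛ ξ₁ ξ₂ X₁ X₂ X₃ : ℂ) := by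
  simp only [Λ, cdot_complexify, realΛ]
  push_cast
  ring

/-! ### Coordinate identities for the cross product on `ℝ³` -/

section CrossIdentities

/-- Coordinates of the cross product. [folklore] -/
theorem cross_apply_zero (a b : ℝ³) : cross a b 0 = a 1 * b 2 - a 2 * b 1 := by
  simp [cross, cross_apply]

/-- Coordinates of the cross product. [folklore] -/
theorem cross_apply_one (a b : ℝ³) : cross a b 1 = a 2 * b 0 - a 0 * b 2 := by
  simp [cross, cross_apply]

/-- Coordinates of the cross product. [folklore] -/
theorem cross_apply_two (a b : ℝ³) : cross a b 2 = a 0 * b 1 - a 1 * b 0 := by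
  simp [cross, cross_apply]

/-- The real inner product on `ℝ³` in coordinates. [folklore] -/
theorem real_inner_fin3 (a b : ℝ³) : ⟪a, b⟫ = a 0 * b 0 + a 1 * b 1 + a 2 * b 2 := by
  simp [PiLp.inner_apply, Fin.sum_univ_three, mul_comm]

/-- **Binet–Cauchy**: `(a × b) · (c × d) = (a·c)(b·d) − (a·d)(b·c)`. [folklore] -/
theorem inner_cross_cross (a b c d : ℝ³) :
    ⟪cross a b, cross c d⟫ = ⟪a, c⟫ * ⟪b, d⟫ - ⟪a, d⟫ * ⟪b, c⟫ := by
  simp only [real_inner_fin3, cross_apply_zero, cross_apply_one, cross_apply_two]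
  ring

/-- `(a × b) · a = 0`. [folklore] -/
theorem inner_cross_self_left (a b : ℝ³) : ⟪cross a b, a⟫ = 0 := by
  simp only [real_inner_fin3, cross_apply_zero, cross_apply_one, cross_apply_two]
  ring

/-- `(a × b) · b = 0`. [folklore] -/
theorem inner_cross_self_right (a b : ℝ³) : ⟪cross a b, b⟫ = 0 := by
  simp only [real_inner_fin3, cross_apply_zero, cross_apply_one, cross_apply_two]
  ring

/-- `a · (a × b) = 0`. [folklore] -/
theorem inner_self_cross_left (a b : ℝ³) : ⟪a, cross a b⟫ = 0 := by
  rw [real_inner_comm, inner_cross_self_left]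

/-- `b · (a × b) = 0`. [folklore] -/
theorem inner_self_cross_right (a b : ℝ³) : ⟪b, cross a b⟫ = 0 := by
  rw [real_inner_comm, inner_cross_self_right]

/-- `‖a × b‖² = ‖a‖²‖b‖² − (a·b)²` (Lagrange). [folklore] -/
theorem norm_cross_sq (a b : ℝ³) : ‖cross a b‖ ^ 2 = ‖a‖ ^ 2 * ‖b‖ ^ 2 - ⟪a, b⟫ ^ 2 := by
  rw [← real_inner_self_eq_norm_sq, inner_cross_cross, real_inner_self_eq_norm_sq,
    real_inner_self_eq_norm_sq, real_inner_comm a b]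
  ring

/-- The cross product is additive in the second argument. [folklore] -/
theorem cross_add_right (a b c : ℝ³) : cross a (b + c) = cross a b + cross a c := by
  simp [cross, map_add]

/-- The cross product commutes with scalars in the second argument. [folklore] -/
theorem cross_smul_right (r : ℝ) (a b : ℝ³) : cross a (r • b) = r • cross a b := by
  simp [cross, map_smul]

/-- The cross product commutes with scalars in the first argument. [folklore] -/
theorem cross_smul_left (r : ℝ) (a b : ℝ³) : cross (r • a) b = r • cross a b := by
  simp [cross, map_smul]

/-- `a × a = 0`. [folklore] -/
theorem cross_self_eq_zero (a : ℝ³) : cross a a = 0 := by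
  ext i
  fin_cases i <;> simp [cross_apply_zero, cross_apply_one, cross_apply_two] <;> ring

end CrossIdentities

/-! ### Rotations about an axis (Tao's `R_ξ^θ`, footnote 6 p. 19) -/

/-- The unit vector `u = ξ/|ξ|` along `ξ` (junk `0` for `ξ = 0`). [cite: Tao2016AveragedNS, §3.7 footnote 6] -/
def udir (ξ : ℝ³) : ℝ³ := ‖ξ‖⁻¹ • ξ

/-- `|ξ/|ξ|| = 1` for `ξ ≠ 0`. [folklore] -/
theorem norm_udir {ξ : ℝ³} (hξ : ξ ≠ 0) : ‖udir ξ‖ = 1 :=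
  norm_smul_inv_norm hξ

/-- `X · u = |ξ|⁻¹ (X · ξ)`. [folklore] -/
theorem inner_udir_right (X ξ : ℝ³) : ⟪X, udir ξ⟫ = ‖ξ‖⁻¹ * ⟪X, ξ⟫ := by
  rw [udir, real_inner_smul_right]

/-- **Rotation by the angle `θ` about the axis `ξ`** (right-hand rule), Tao 2016, footnote 6,
p. 19: with `u = ξ/|ξ|`, `R_ξ^θ X := (X · u) u + cos θ (X − (X · u) u) + sin θ (u × X)`
(Rodrigues' formula). Total in `ξ` (for `ξ = 0`, `u = 0` and `R_0^θ X = cos θ X`). [cite: Tao2016AveragedNS, §3.7 footnote 6 p. 19] -/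
def rodRot (ξ : ℝ³) (θ : ℝ) (X : ℝ³) : ℝ³ :=
  ⟪X, udir ξ⟫ • udir ξ + Real.cos θ • (X - ⟪X, udir ξ⟫ • udir ξ) + Real.sin θ • cross (udir ξ) X

/-- On the plane `ξ^⊥` the rotation acts by `R_ξ^θ X = cos θ X + sin θ (u × X)`. [cite: Tao2016AveragedNS, §3.7 footnote 6 p. 19] -/
theorem rodRot_of_inner_eq_zero {ξ X : ℝ³} (h : ⟪X, ξ⟫ = 0) (θ : ℝ) :
    rodRot ξ θ X = Real.cos θ • X + Real.sin θ • cross (udir ξ) X := by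
  have h0 : ⟪X, udir ξ⟫ = 0 := by rw [inner_udir_right, h, mul_zero]
  simp [rodRot, h0]

/-- `R_ξ^0 = id`. [folklore] -/
theorem rodRot_zero (ξ X : ℝ³) : rodRot ξ 0 X = X := by
  simp [rodRot]

/-- The axis is fixed: `R_ξ^θ ξ = ξ`. [folklore] -/
theorem rodRot_axis (ξ : ℝ³) (θ : ℝ) : rodRot ξ θ ξ = ξ := by
  by_cases hξ : ξ = 0
  · simp [rodRot, hξ, udir, cross_self_eq_zero]
  have hn : ‖ξ‖ ≠ 0 := norm_ne_zero_iff.mpr hξ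
  have h1 : ⟪ξ, udir ξ⟫ • udir ξ = ξ := by
    rw [inner_udir_right, real_inner_self_eq_norm_sq, udir, smul_smul]
    rw [show ‖ξ‖⁻¹ * ‖ξ‖ ^ 2 * ‖ξ‖⁻¹ = 1 by field_simp]
    exact one_smul _ _
  have h2 : cross (udir ξ) ξ = 0 := by
    rw [udir, cross_smul_left, cross_self_eq_zero, smul_zero]
  rw [rodRot, h1, sub_self, smul_zero, add_zero, h2, smul_zero, add_zero]

/-- `R_ξ^θ` is linear in `X`. [folklore] -/
theorem rodRot_add (ξ : ℝ³) (θ : ℝ) (X Y : ℝ³) : rodRot ξ θ (X + Y) = rodRot ξ θ X + rodRot ξ θ Y := by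
  unfold rodRot
  rw [inner_add_left, cross_add_right]
  module

/-- `R_ξ^θ` commutes with scalars. [folklore] -/
theorem rodRot_smul (ξ : ℝ³) (θ : ℝ) (r : ℝ) (X : ℝ³) : rodRot ξ θ (r • X) = r • rodRot ξ θ X := by
  unfold rodRot
  rw [real_inner_smul_left, cross_smul_right]
  module

/-- **`R_ξ^θ` is an isometry** (`ξ ≠ 0`): `|R_ξ^θ X| = |X|` (the three summands `(X·u)u`,
`cos θ X_⊥`, `sin θ u × X_⊥` are pairwise orthogonal and `|u × X_⊥| = |X_⊥|`). [folklore] -/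
theorem norm_rodRot {ξ : ℝ³} (hξ : ξ ≠ 0) (θ : ℝ) (X : ℝ³) : ‖rodRot ξ θ X‖ = ‖X‖ := by
  set u := udir ξ with hu
  have hu1 : ‖u‖ = 1 := norm_udir hξ
  set a : ℝ := ⟪X, u⟫ with ha
  set P : ℝ³ := X - a • u with hP
  have hPu : ⟪P, u⟫ = 0 := by
    rw [hP, inner_sub_left, real_inner_smul_left, real_inner_self_eq_norm_sq, hu1, ← ha]
    ring
  have hcr : cross u X = cross u P := by
    rw [hP, sub_eq_add_neg, cross_add_right, ← neg_smul, cross_smul_right, cross_self_eq_zero, smul_zero,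
      add_zero]
  have hrot : rodRot ξ θ X = a • u + (Real.cos θ • P + Real.sin θ • cross u P) := by
    rw [rodRot, ← hu, ← ha, ← hP, hcr, add_assoc]
  -- pairwise orthogonality and norms
  have h1 : ⟪u, P⟫ = 0 := by rw [real_inner_comm, hPu]
  have h2 : ⟪u, cross u P⟫ = 0 := inner_self_cross_left u P
  have h3 : ⟪P, cross u P⟫ = 0 := inner_self_cross_right u P
  have h4 : ‖cross u P‖ ^ 2 = ‖P‖ ^ 2 := by
    rw [norm_cross_sq, hu1, h1]
    ring
  have hX : ‖X‖ ^ 2 = a ^ 2 + ‖P‖ ^ 2 := by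
    have : X = a • u + P := by rw [hP]; abel
    rw [this, ← real_inner_self_eq_norm_sq, inner_add_left, inner_add_right, inner_add_right,
      real_inner_smul_left, real_inner_smul_right, real_inner_smul_left, real_inner_smul_right,
      real_inner_self_eq_norm_sq, hu1, h1, hPu, real_inner_self_eq_norm_sq]
    ring
  have huu : ⟪u, u⟫ = 1 := by rw [real_inner_self_eq_norm_sq, hu1, one_pow]
  have hcc : ⟪cross u P, cross u P⟫ = ‖P‖ ^ 2 := by rw [real_inner_self_eq_norm_sq, h4]
  have hPP : ⟪P, P⟫ = ‖P‖ ^ 2 := real_inner_self_eq_norm_sq P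
  have h2' : ⟪cross u P, u⟫ = 0 := inner_cross_self_left u P
  have h3' : ⟪cross u P, P⟫ = 0 := inner_cross_self_right u P
  have hcs : Real.cos θ ^ 2 + Real.sin θ ^ 2 = 1 := Real.cos_sq_add_sin_sq θ
  have hR : ‖rodRot ξ θ X‖ ^ 2 = a ^ 2 + ‖P‖ ^ 2 := by
    rw [hrot, ← real_inner_self_eq_norm_sq]
    simp only [inner_add_left, inner_add_right, real_inner_smul_left, real_inner_smul_right,
      huu, h1, hPu, h2, h3, h2', h3', hcc, hPP, mul_zero, add_zero, zero_add, mul_one]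
    linear_combination ‖P‖ ^ 2 * hcs
  have h0 : 0 ≤ ‖rodRot ξ θ X‖ := norm_nonneg _
  have h0' : 0 ≤ ‖X‖ := norm_nonneg _
  nlinarith [hR, hX, sq_nonneg (‖rodRot ξ θ X‖ - ‖X‖), sq_nonneg (‖rodRot ξ θ X‖ + ‖X‖)]


/-! ### The function `Θ` of (3.22) and its expansion (§3.9, first display p. 20) -/

/-- **Tao's `Θ_{η₁,η₂,η₃}` (3.22)**: for base vectors `η = (η₁, η₂, η₃)` and a unit normal `n`,
`Θ_η(γ₁,γ₂,γ₃) := Λ_{η₁,η₂,η₃}(R_{η₁}^{γ₁} n, R_{η₂}^{γ₂} n, R_{η₃}^{γ₃} n)` (indices `0,1,2` in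
Lean; `Λ` depends on `η₁, η₂` only). [cite: Tao2016AveragedNS, (3.22)] -/
def thetaFn (η : Fin 3 → ℝ³) (n : ℝ³) (γ : Fin 3 → ℝ) : ℝ :=
  realΛ (η 0) (η 1) (rodRot (η 0) (γ 0) n) (rodRot (η 1) (γ 1) n) (rodRot (η 2) (γ 2) n)

section ThetaExpansion

variable {η : Fin 3 → ℝ³} {n : ℝ³}

/-- `R_{ηⱼ}^γ n · η_k = sin γ ((uⱼ × n) · η_k)` when `n ⊥ ηⱼ, η_k`. [cite: Tao2016AveragedNS, §3.9 p. 20] -/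
theorem inner_rodRot_normal_base (hn : ∀ j, ⟪n, η j⟫ = 0) (j k : Fin 3) (γ : ℝ) :
    ⟪rodRot (η j) γ n, η k⟫ = Real.sin γ * ⟪cross (udir (η j)) n, η k⟫ := by
  rw [rodRot_of_inner_eq_zero (hn j), inner_add_left, real_inner_smul_left, real_inner_smul_left, hn k,
    mul_zero, zero_add]

/-- `R_{ηⱼ}^γ n · R_{η_k}^δ n = cos γ cos δ + (uⱼ · u_k) sin γ sin δ` when `|n| = 1`, `n ⊥ ηⱼ, η_k`
(Binet–Cauchy `(uⱼ × n)·(u_k × n) = uⱼ·u_k`). [cite: Tao2016AveragedNS, §3.9 p. 20] -/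
theorem inner_rodRot_normal_rodRot_normal (hn1 : ‖n‖ = 1) (hn : ∀ j, ⟪n, η j⟫ = 0) (j k : Fin 3)
    (γ δ : ℝ) :
    ⟪rodRot (η j) γ n, rodRot (η k) δ n⟫ =
      Real.cos γ * Real.cos δ + ⟪udir (η j), udir (η k)⟫ * Real.sin γ * Real.sin δ := by
  have hnn : ⟪n, n⟫ = 1 := by rw [real_inner_self_eq_norm_sq, hn1, one_pow]
  have hu : ∀ i, ⟪udir (η i), n⟫ = 0 := fun i => by
    rw [udir, real_inner_smul_left, real_inner_comm, hn i, mul_zero]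
  have hu' : ∀ i, ⟪n, udir (η i)⟫ = 0 := fun i => by rw [real_inner_comm, hu i]
  rw [rodRot_of_inner_eq_zero (hn j), rodRot_of_inner_eq_zero (hn k)]
  simp only [inner_add_left, inner_add_right, real_inner_smul_left, real_inner_smul_right, hnn,
    inner_self_cross_right, inner_cross_self_right, inner_cross_cross, hu, hu', mul_zero, sub_zero,
    add_zero, zero_add, mul_one]
  ring

/-- **The expansion of `Θ` (Tao 2016, §3.9, first two displays of p. 20)**: for a unit vector
`n` orthogonal to `η₁, η₂, η₃` and `uⱼ = ηⱼ/|ηⱼ|`,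
`Θ_η(γ) = sin γ₁ ((u₁ × n)·η₂)(cos γ₂ cos γ₃ + (u₂·u₃) sin γ₂ sin γ₃) + sin γ₂ ((u₂ × n)·η₁)(cos γ₁ cos γ₃ + (u₁·u₃) sin γ₁ sin γ₃)`.
[cite: Tao2016AveragedNS, §3.9 p. 20] -/
theorem thetaFn_expand (hn1 : ‖n‖ = 1) (hn : ∀ j, ⟪n, η j⟫ = 0) (γ : Fin 3 → ℝ) :
    thetaFn η n γ =
      Real.sin (γ 0) * ⟪cross (udir (η 0)) n, η 1⟫ *
          (Real.cos (γ 1) * Real.cos (γ 2) + ⟪udir (η 1), udir (η 2)⟫ * Real.sin (γ 1) * Real.sin (γ 2)) +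
        Real.sin (γ 1) * ⟪cross (udir (η 1)) n, η 0⟫ *
          (Real.cos (γ 0) * Real.cos (γ 2) + ⟪udir (η 0), udir (η 2)⟫ * Real.sin (γ 0) * Real.sin (γ 2)) := by
  unfold thetaFn realΛ
  rw [inner_rodRot_normal_base hn 0 1, inner_rodRot_normal_base hn 1 0,
    inner_rodRot_normal_rodRot_normal hn1 hn 1 2, inner_rodRot_normal_rodRot_normal hn1 hn 0 2]

end ThetaExpansion


/-! ### The Fourier coefficients `c_σ` of `Θ` ((3.24) and the display before it, p. 20) -/

/-- Sums over the eight sign patterns `σ ∈ {−1,+1}³` (as `Fin 3 → ℤˣ`), expanded. [folklore] -/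
theorem sum_signVec3 {M : Type*} [AddCommMonoid M] (f : (Fin 3 → ℤˣ) → M) :
    ∑ σ, f σ = f ![1, 1, 1] + f ![1, 1, -1] + f ![1, -1, 1] + f ![1, -1, -1] +
      f ![-1, 1, 1] + f ![-1, 1, -1] + f ![-1, -1, 1] + f ![-1, -1, -1] := by
  have h1 : (1 : ℤˣ) ≠ -1 := by decide
  have step : ∀ (k : ℕ) (g : (Fin (k + 1) → ℤˣ) → M),
      ∑ σ, g σ = ∑ τ : Fin k → ℤˣ, g (Fin.cons 1 τ) + ∑ τ : Fin k → ℤˣ, g (Fin.cons (-1) τ) := by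
    intro k g
    rw [← Fintype.sum_equiv (Fin.consEquiv fun _ => ℤˣ) (fun p => g (Fin.cons p.1 p.2)) g (fun p => rfl),
      Fintype.sum_prod_type, UnitsInt.univ, Finset.sum_pair h1]
  have h0 : ∀ g : (Fin 0 → ℤˣ) → M, ∑ σ, g σ = g Fin.elim0 := fun g => by
    rw [Fintype.sum_unique]
    exact congrArg g (Subsingleton.elim _ _)
  rw [step, step, step, h0, h0, step, h0, h0, step, step, h0, h0, step, h0, h0]
  have e : ∀ a b c : ℤˣ, (Fin.cons a (Fin.cons b (Fin.cons c Fin.elim0)) : Fin 3 → ℤˣ) = ![a, b, c] := by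
    intro a b c
    funext i
    fin_cases i <;> rfl
  simp only [e]
  abel

/-- **The Fourier coefficients `c_{σ₁,σ₂,σ₃}(η₁,η₂,η₃)` of `Θ`** (Tao 2016, §3.9, the display
before "But by (3.17)", p. 20): with `uⱼ = ηⱼ/|ηⱼ|` and the unit normal `n`,
`c_σ = (1/8i) ( ((u₁ × n)·η₂) σ₁ (1 − (u₂·u₃) σ₂σ₃) + ((u₂ × n)·η₁) σ₂ (1 − (u₁·u₃) σ₁σ₃) )`
(indices `0,1,2` in Lean). [cite: Tao2016AveragedNS, §3.9 p. 20] -/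
def cSigma (η : Fin 3 → ℝ³) (n : ℝ³) (σ : Fin 3 → ℤˣ) : ℂ :=
  1 / (8 * Complex.I) *
    ((⟪cross (udir (η 0)) n, η 1⟫ : ℂ) * ((σ 0 : ℤ) : ℂ) *
        (1 - (⟪udir (η 1), udir (η 2)⟫ : ℂ) * ((σ 1 : ℤ) : ℂ) * ((σ 2 : ℤ) : ℂ)) +
      (⟪cross (udir (η 1)) n, η 0⟫ : ℂ) * ((σ 1 : ℤ) : ℂ) *
        (1 - (⟪udir (η 0), udir (η 2)⟫ : ℂ) * ((σ 0 : ℤ) : ℂ) * ((σ 2 : ℤ) : ℂ)))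

/-- `1/(8i) = −i/8`. [folklore] -/
theorem one_div_eight_mul_I : (1 : ℂ) / (8 * Complex.I) = -(Complex.I / 8) := by
  rw [div_mul_eq_div_div, div_right_comm, Complex.div_I]
  ring

/-- **`Θ` is a trigonometric polynomial of degree `(1,1,1)` with coefficients `c_σ`** (Tao 2016,
(3.24)/"cdoc", p. 20): for a unit `n` orthogonal to `η₁, η₂, η₃`,
`Θ_η(γ₁,γ₂,γ₃) = Σ_{σ ∈ {−1,+1}³} c_σ(η) e^{i(σ₁γ₁ + σ₂γ₂ + σ₃γ₃)}`
(from `sin γ = (1/2i) Σ_{σ=±1} σ e^{iσγ}`, `cos γ = ½ Σ_{σ=±1} e^{iσγ}`). [cite: Tao2016AveragedNS, §3.9 (3.24) p. 20] -/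
theorem thetaFn_eq_sum_cSigma {η : Fin 3 → ℝ³} {n : ℝ³} (hn1 : ‖n‖ = 1) (hn : ∀ j, ⟪n, η j⟫ = 0)
    (γ : Fin 3 → ℝ) :
    (thetaFn η n γ : ℂ) =
      ∑ σ : Fin 3 → ℤˣ, cSigma η n σ * Complex.exp (Complex.I * ∑ j, ((σ j : ℤ) : ℂ) * (γ j : ℂ)) := by
  rw [thetaFn_expand hn1 hn γ, sum_signVec3]
  simp only [cSigma, one_div_eight_mul_I, Fin.sum_univ_three, Matrix.cons_val_zero, Matrix.cons_val_one,
    Matrix.cons_val_two, Matrix.head_cons, Matrix.tail_cons, Units.val_one, Units.val_neg, Int.cast_one,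
    Int.cast_neg, one_mul, mul_one, mul_neg, neg_mul, neg_neg]
  push_cast
  -- everything in terms of `E_j = exp (γ_j i)` and `E_j⁻¹`
  simp only [Complex.cos, Complex.sin]
  simp only [mul_add, mul_neg, Complex.exp_add, Complex.exp_neg, neg_mul]
  simp only [mul_comm Complex.I]
  have hE0 : Complex.exp ((γ 0 : ℂ) * Complex.I) ≠ 0 := Complex.exp_ne_zero _
  have hE1 : Complex.exp ((γ 1 : ℂ) * Complex.I) ≠ 0 := Complex.exp_ne_zero _
  have hE2 : Complex.exp ((γ 2 : ℂ) * Complex.I) ≠ 0 := Complex.exp_ne_zero _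
  field_simp
  ring_nf
  simp only [Complex.I_sq]
  ring


/-! ### The non-degeneracy condition (3.24) at the normalised configuration (3.7) -/

/-- The reference unit normal `(0,0,1)` of §3.8 ("we may normalise `n` to be close to `(0,0,1)`"). [cite: Tao2016AveragedNS, §3.8 p. 19] -/
def northVec : ℝ³ := !₂[0, 0, 1]

/-- `|(0,0,1)| = 1`. [folklore] -/
theorem norm_northVec : ‖northVec‖ = 1 := by
  simp [northVec, EuclideanSpace.norm_eq, Fin.sum_univ_three]

/-- `(0,0,1) ⊥ ξⱼ⁰` for the base frequencies (3.7) (which lie in the plane `{ξ₃ = 0}`). [cite: Tao2016AveragedNS, (3.7)] -/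
theorem inner_northVec_xi0 (j : Fin 3) : ⟪northVec, xi0 j⟫ = 0 := by
  fin_cases j <;> simp [real_inner_fin3, northVec, xi0]

/-- `u₁⁰ = ξ₁⁰` (a unit vector). [cite: Tao2016AveragedNS, (3.7)] -/
theorem udir_xi0_zero : udir (xi0 0) = xi0 0 := by
  rw [udir, norm_xi0_zero, inv_one, one_smul]

/-- `u₂⁰ = ξ₂⁰/√2`. [cite: Tao2016AveragedNS, (3.7)] -/
theorem udir_xi0_one : udir (xi0 1) = (Real.sqrt 2)⁻¹ • xi0 1 := by
  rw [udir, norm_xi0_one]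

/-- `u₃⁰ = ξ₃⁰` (a unit vector). [cite: Tao2016AveragedNS, (3.7)] -/
theorem udir_xi0_two : udir (xi0 2) = xi0 2 := by
  rw [udir, norm_xi0_two, inv_one, one_smul]

/-- `(u₁⁰ × n) · ξ₂⁰ = -1` at (3.7) with `n = (0,0,1)` (Tao: "`= -1 + O(ε₀)`"). [cite: Tao2016AveragedNS, §3.9 p. 20] -/
theorem crossTerm_xi0_zero : ⟪cross (udir (xi0 0)) northVec, xi0 1⟫ = -1 := by
  rw [udir_xi0_zero]
  simp [real_inner_fin3, cross_apply_zero, cross_apply_one, cross_apply_two, northVec, xi0]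

/-- `(u₂⁰ × n) · ξ₁⁰ = 1/√2` at (3.7) with `n = (0,0,1)`. [cite: Tao2016AveragedNS, §3.9 p. 20] -/
theorem crossTerm_xi0_one : ⟪cross (udir (xi0 1)) northVec, xi0 0⟫ = (Real.sqrt 2)⁻¹ := by
  rw [udir_xi0_one, cross_smul_left, real_inner_smul_left]
  simp [real_inner_fin3, cross_apply_zero, cross_apply_one, cross_apply_two, northVec, xi0]

/-- `u₂⁰ · u₃⁰ = -1/√2`. [cite: Tao2016AveragedNS, §3.9 p. 20] -/
theorem inner_udir_xi0_one_two : ⟪udir (xi0 1), udir (xi0 2)⟫ = -(Real.sqrt 2)⁻¹ := by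
  rw [udir_xi0_one, udir_xi0_two, real_inner_smul_left]
  simp [real_inner_fin3, xi0]

/-- `u₁⁰ · u₃⁰ = 0`. [cite: Tao2016AveragedNS, §3.9 p. 20] -/
theorem inner_udir_xi0_zero_two : ⟪udir (xi0 0), udir (xi0 2)⟫ = 0 := by
  rw [udir_xi0_zero, udir_xi0_two]
  simp [real_inner_fin3, xi0]

/-- The real number `r_σ = -σ₁ + σ₂/√2 - σ₁σ₂σ₃/√2` with `c_σ(ξ⁰) = r_σ/(8i)`. [cite: Tao2016AveragedNS, §3.9 p. 20] -/
def rSigma (σ : Fin 3 → ℤˣ) : ℝ :=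
  -((σ 0 : ℤ) : ℝ) + (Real.sqrt 2)⁻¹ * ((σ 1 : ℤ) : ℝ) -
    (Real.sqrt 2)⁻¹ * (((σ 0 : ℤ) : ℝ) * ((σ 1 : ℤ) : ℝ) * ((σ 2 : ℤ) : ℝ))

/-- **`c_σ` at the normalised configuration (3.7)** with `n = (0,0,1)`:
`c_σ(ξ⁰) = (1/8i)(-σ₁ + σ₂/√2 - σ₁σ₂σ₃/√2)` (Tao, last display of §3.9: "`c_σ = -(1/8i)(-σ₁ + σ₂/√2 + σ₁σ₂σ₃/√2) + O(ε₀)`"; inserting the four values listed just before it into the source's own formula for `c_σ` gives the expression here, which is the printed one with `(σ₁,σ₂) ↦ (-σ₁,-σ₂)` — the set of values, and the non-degeneracy, are the same). [cite: Tao2016AveragedNS, §3.9 p. 20] -/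
theorem cSigma_xi0 (σ : Fin 3 → ℤˣ) : cSigma xi0 northVec σ = 1 / (8 * Complex.I) * (rSigma σ : ℂ) := by
  unfold cSigma rSigma
  rw [crossTerm_xi0_zero, crossTerm_xi0_one, inner_udir_xi0_one_two, inner_udir_xi0_zero_two]
  push_cast
  ring

/-- `|r_σ| ≥ √2 - 1` for all eight sign patterns (the values are `±1`, `±(√2 - 1)`, `±(√2 + 1)`). [cite: Tao2016AveragedNS, §3.9 p. 20] -/
theorem abs_rSigma_ge (σ : Fin 3 → ℤˣ) : Real.sqrt 2 - 1 ≤ |rSigma σ| := by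
  have h2 : Real.sqrt 2 * Real.sqrt 2 = 2 := Real.mul_self_sqrt (by norm_num)
  have h2' : 0 ≤ Real.sqrt 2 := Real.sqrt_nonneg 2
  have hpos : 0 < Real.sqrt 2 := Real.sqrt_pos.mpr (by norm_num)
  have hinv : (Real.sqrt 2)⁻¹ = Real.sqrt 2 / 2 := by
    rw [eq_div_iff two_ne_zero]
    calc (Real.sqrt 2)⁻¹ * 2 = (Real.sqrt 2)⁻¹ * (Real.sqrt 2 * Real.sqrt 2) := by rw [h2]
      _ = Real.sqrt 2 := by rw [← mul_assoc, inv_mul_cancel₀ hpos.ne', one_mul]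
  unfold rSigma
  rw [hinv]
  rcases Int.units_eq_one_or (σ 0) with h0 | h0 <;> rcases Int.units_eq_one_or (σ 1) with h1 | h1 <;>
    rcases Int.units_eq_one_or (σ 2) with h3 | h3 <;> simp only [h0, h1, h3, Units.val_one, Units.val_neg,
      Int.cast_one, Int.cast_neg] <;> rw [le_abs] <;>
    first
    | exact Or.inl (by nlinarith)
    | exact Or.inr (by nlinarith)

/-- **Non-degeneracy (3.24) at the configuration (3.7)**: `|c_σ(ξ⁰)| ≥ (√2 - 1)/8 > 0` for all
`σ ∈ {−1,+1}³` ("As `-σ₁ + σ₂/√2 + σ₁σ₂σ₃/√2` is bounded away from zero … the non-degeneracy claim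
(3.24) follows"). [cite: Tao2016AveragedNS, §3.9 (3.24) p. 20] -/
theorem norm_cSigma_xi0_ge (σ : Fin 3 → ℤˣ) : (Real.sqrt 2 - 1) / 8 ≤ ‖cSigma xi0 northVec σ‖ := by
  rw [cSigma_xi0, norm_mul, norm_div, norm_one, norm_mul, Complex.norm_I, mul_one, Complex.norm_real,
    Real.norm_eq_abs]
  norm_num
  rw [div_eq_mul_inv, mul_comm]
  have := abs_rSigma_ge σ
  nlinarith

/-- `c_σ(ξ⁰) ≠ 0`. [cite: Tao2016AveragedNS, §3.9 (3.24) p. 20] -/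
theorem cSigma_xi0_ne_zero (σ : Fin 3 → ℤˣ) : cSigma xi0 northVec σ ≠ 0 := by
  intro h
  have h1 := norm_cSigma_xi0_ge σ
  rw [h, norm_zero] at h1
  have h2 : (1 : ℝ) < Real.sqrt 2 := by
    rw [show (1 : ℝ) = Real.sqrt 1 from Real.sqrt_one.symm]
    exact Real.sqrt_lt_sqrt (by norm_num) (by norm_num)
  linarith


/-! ### Non-degeneracy (3.24) near the configuration (3.7) -/

/-- A unit vector orthogonal to `ξ₁⁰ = (0,1,0)` and `ξ₃⁰ = (1,0,0)` at distance `≤ 1` from `(0,0,1)`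
is `(0,0,1)`. [folklore] -/
theorem eq_northVec {n : ℝ³} (hn1 : ‖n‖ = 1) (hn : ∀ j, ⟪n, xi0 j⟫ = 0) (hnN : ‖n - northVec‖ ≤ 1) :
    n = northVec := by
  have h1 : n 1 = 0 := by simpa [real_inner_fin3, xi0] using hn 0
  have h0 : n 0 = 0 := by simpa [real_inner_fin3, xi0] using hn 2
  have hsq : n 0 * n 0 + n 1 * n 1 + n 2 * n 2 = 1 := by
    rw [← real_inner_fin3, real_inner_self_eq_norm_sq, hn1, one_pow]
  have hN : (n - northVec) 0 * (n - northVec) 0 + (n - northVec) 1 * (n - northVec) 1 +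
      (n - northVec) 2 * (n - northVec) 2 ≤ 1 := by
    rw [← real_inner_fin3, real_inner_self_eq_norm_sq]
    exact pow_le_one₀ (norm_nonneg _) hnN
  simp only [PiLp.sub_apply, northVec] at hN
  simp only [Matrix.cons_val_zero, Matrix.cons_val_one, Matrix.cons_val_two, Matrix.head_cons,
    Matrix.tail_cons, sub_zero] at hN
  rw [h0, h1] at hsq hN
  have h2 : n 2 = 1 := by nlinarith [hsq, hN]
  ext i
  fin_cases i <;> simp [northVec, h0, h1, h2]

/-- `ξ/|ξ|` depends continuously on `ξ ≠ 0`. [folklore] -/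
theorem continuousAt_udir {ξ : ℝ³} (hξ : ξ ≠ 0) : ContinuousAt udir ξ := by
  change ContinuousAt (fun ξ : ℝ³ => ‖ξ‖⁻¹ • ξ) ξ
  exact (continuous_norm.continuousAt.inv₀ (norm_ne_zero_iff.mpr hξ)).smul continuousAt_id

/-- The cross product is (jointly) continuous. [folklore] -/
theorem continuous_cross : Continuous fun p : ℝ³ × ℝ³ => cross p.1 p.2 :=
  crossCLM.continuous₂

/-- `c_σ(η, n)` depends continuously on `(η, n)` where all `ηⱼ ≠ 0`. [folklore] -/
theorem continuousAt_cSigma (σ : Fin 3 → ℤˣ) {p : (Fin 3 → ℝ³) × ℝ³} (hp : ∀ j, p.1 j ≠ 0) :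
    ContinuousAt (fun q : (Fin 3 → ℝ³) × ℝ³ => cSigma q.1 q.2 σ) p := by
  have hev : ∀ j, ContinuousAt (fun q : (Fin 3 → ℝ³) × ℝ³ => q.1 j) p := fun j =>
    ((continuous_apply j).comp continuous_fst).continuousAt
  have hu : ∀ j, ContinuousAt (fun q : (Fin 3 → ℝ³) × ℝ³ => udir (q.1 j)) p := fun j =>
    (continuousAt_udir (hp j)).comp (f := fun q : (Fin 3 → ℝ³) × ℝ³ => q.1 j) (hev j)
  have hn : ContinuousAt (fun q : (Fin 3 → ℝ³) × ℝ³ => q.2) p := continuous_snd.continuousAt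
  have hcr : ∀ j, ContinuousAt (fun q : (Fin 3 → ℝ³) × ℝ³ => cross (udir (q.1 j)) q.2) p := fun j =>
    ((crossCLM.continuous.continuousAt.comp (f := fun q : (Fin 3 → ℝ³) × ℝ³ => udir (q.1 j))
      (hu j))).clm_apply hn
  have hA : ∀ j k, ContinuousAt (fun q : (Fin 3 → ℝ³) × ℝ³ =>
      ((⟪cross (udir (q.1 j)) q.2, q.1 k⟫ : ℝ) : ℂ)) p := fun j k =>
    Complex.continuous_ofReal.continuousAt.comp ((hcr j).inner (hev k))
  have hP : ∀ j k, ContinuousAt (fun q : (Fin 3 → ℝ³) × ℝ³ =>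
      ((⟪udir (q.1 j), udir (q.1 k)⟫ : ℝ) : ℂ)) p := fun j k =>
    Complex.continuous_ofReal.continuousAt.comp ((hu j).inner (hu k))
  have hT1 : ContinuousAt (fun q : (Fin 3 → ℝ³) × ℝ³ =>
      ((⟪cross (udir (q.1 0)) q.2, q.1 1⟫ : ℝ) : ℂ) * ((σ 0 : ℤ) : ℂ) *
        (1 - ((⟪udir (q.1 1), udir (q.1 2)⟫ : ℝ) : ℂ) * ((σ 1 : ℤ) : ℂ) * ((σ 2 : ℤ) : ℂ))) p :=
    ((hA 0 1).mul continuousAt_const).mul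
      (continuousAt_const.sub (((hP 1 2).mul continuousAt_const).mul continuousAt_const))
  have hT2 : ContinuousAt (fun q : (Fin 3 → ℝ³) × ℝ³ =>
      ((⟪cross (udir (q.1 1)) q.2, q.1 0⟫ : ℝ) : ℂ) * ((σ 1 : ℤ) : ℂ) *
        (1 - ((⟪udir (q.1 0), udir (q.1 2)⟫ : ℝ) : ℂ) * ((σ 0 : ℤ) : ℂ) * ((σ 2 : ℤ) : ℂ))) p :=
    ((hA 1 0).mul continuousAt_const).mul
      (continuousAt_const.sub (((hP 0 2).mul continuousAt_const).mul continuousAt_const))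
  unfold cSigma
  exact continuousAt_const.mul (hT1.add hT2)

/-- **Non-degeneracy (3.24) for base vectors near (3.7)** (Tao 2016, end of §3.9: "`c_σ(η) =
-(1/8i)(…) + O(ε₀)` … the non-degeneracy claim (3.24) follows for `ε₀` small enough"): there is
`δ > 0` such that `c_σ(η, n) ≠ 0` for all sign patterns `σ`, all `η = (η₁,η₂,η₃)` with
`|ηⱼ - ξⱼ⁰| ≤ δ`, and every unit vector `n` orthogonal to the `ηⱼ` on the side of `(0,0,1)`
(`|n - (0,0,1)| ≤ 1`, Tao's "normalise `n` to be close to `(0,0,1)`"). Proof: compactness of the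
configuration set, continuity of `c_σ`, and `c_σ(ξ⁰, (0,0,1)) ≠ 0`. [cite: Tao2016AveragedNS, §3.9 (3.24) p. 20] -/
theorem cSigma_ne_zero_near_xi0 :
    ∃ δ : ℝ, 0 < δ ∧ ∀ (η : Fin 3 → ℝ³) (n : ℝ³), (∀ j, ‖η j - xi0 j‖ ≤ δ) → ‖n‖ = 1 →
      (∀ j, ⟪n, η j⟫ = 0) → ‖n - northVec‖ ≤ 1 → ∀ σ, cSigma η n σ ≠ 0 := by
  -- the compact configuration set
  set K : Set ((Fin 3 → ℝ³) × ℝ³) := {p | (∀ j, ‖p.1 j - xi0 j‖ ≤ 1 / 2) ∧ ‖p.2‖ = 1 ∧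
      (∀ j, ⟪p.2, p.1 j⟫ = 0) ∧ ‖p.2 - northVec‖ ≤ 1} with hK
  have hxi1 : ∀ j, (1 : ℝ) ≤ ‖xi0 j‖ ∧ ‖xi0 j‖ ≤ 3 / 2 := by
    intro j
    match j with
    | 0 => rw [norm_xi0_zero]; norm_num
    | 1 =>
      rw [norm_xi0_one]
      have h2 := Real.sq_sqrt (show (0 : ℝ) ≤ 2 by norm_num)
      constructor <;> nlinarith [Real.sqrt_nonneg 2]
    | 2 => rw [norm_xi0_two]; norm_num
  have hne0 : ∀ p ∈ K, ∀ j, p.1 j ≠ 0 := by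
    intro p hp j h0
    have h1 := hp.1 j
    rw [h0, zero_sub, norm_neg] at h1
    linarith [(hxi1 j).1]
  have hKclosed : IsClosed K := by
    rw [hK]
    simp only [Set.setOf_and, Set.setOf_forall]
    refine (isClosed_iInter fun j => ?_).inter (IsClosed.inter ?_ ((isClosed_iInter fun j => ?_).inter ?_))
    · exact isClosed_le (by fun_prop) continuous_const
    · exact isClosed_eq (by fun_prop) continuous_const
    · exact isClosed_eq (continuous_snd.inner ((continuous_apply j).comp continuous_fst)) continuous_const
    · exact isClosed_le (by fun_prop) continuous_const
  have hKbdd : Bornology.IsBounded K := by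
    refine isBounded_iff_forall_norm_le.mpr ⟨2, fun p hp => ?_⟩
    rw [Prod.norm_def, max_le_iff]
    refine ⟨(pi_norm_le_iff_of_nonneg (by norm_num)).mpr fun j => ?_, by rw [hp.2.1]; norm_num⟩
    calc ‖p.1 j‖ = ‖(p.1 j - xi0 j) + xi0 j‖ := by rw [sub_add_cancel]
      _ ≤ ‖p.1 j - xi0 j‖ + ‖xi0 j‖ := norm_add_le _ _
      _ ≤ 2 := by linarith [hp.1 j, (hxi1 j).2]
  have hKc : IsCompact K := Metric.isCompact_of_isClosed_isBounded hKclosed hKbdd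
  -- the deviation from the configuration (3.7)
  set d : (Fin 3 → ℝ³) × ℝ³ → ℝ := fun p => ∑ j, ‖p.1 j - xi0 j‖ with hd
  have hdc : Continuous d := by rw [hd]; fun_prop
  have hzero : ∀ p ∈ K, d p = 0 → p = (xi0, northVec) := by
    intro p hp h0
    have h1 : ∀ j, p.1 j = xi0 j := by
      intro j
      have := (Finset.sum_eq_zero_iff_of_nonneg fun j _ => norm_nonneg (p.1 j - xi0 j)).mp h0 j
        (Finset.mem_univ j)
      exact sub_eq_zero.mp (norm_eq_zero.mp this)
    have hη : p.1 = xi0 := funext h1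
    obtain ⟨-, hn1, hn, hnN⟩ := hp
    have hn' : ∀ j, ⟪p.2, xi0 j⟫ = 0 := fun j => by rw [← h1 j]; exact hn j
    exact Prod.ext hη (eq_northVec hn1 hn' hnN)
  -- for each sign pattern, a threshold
  have key : ∀ σ : Fin 3 → ℤˣ, ∃ δ : ℝ, 0 < δ ∧ ∀ p ∈ K, d p < δ → cSigma p.1 p.2 σ ≠ 0 := by
    intro σ
    have hg : ContinuousOn (fun q : (Fin 3 → ℝ³) × ℝ³ => cSigma q.1 q.2 σ) K := fun p hp =>
      (continuousAt_cSigma σ (hne0 p hp)).continuousWithinAt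
    set Z := K ∩ (fun q : (Fin 3 → ℝ³) × ℝ³ => cSigma q.1 q.2 σ) ⁻¹' {0} with hZ
    have hZclosed : IsClosed Z := hg.preimage_isClosed_of_isClosed hKclosed isClosed_singleton
    have hZc : IsCompact Z := hKc.of_isClosed_subset hZclosed Set.inter_subset_left
    by_cases hZne : Z.Nonempty
    · obtain ⟨p₀, hp₀, hmin⟩ := hZc.exists_isMinOn hZne hdc.continuousOn
      have hd0 : 0 ≤ d p₀ := Finset.sum_nonneg fun j _ => norm_nonneg (p₀.1 j - xi0 j)
      refine ⟨d p₀, ?_, fun p hp hlt h0 => ?_⟩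
      · rcases hd0.lt_or_eq with hpos | h0
        · exact hpos
        · exfalso
          have hp0 := hzero p₀ hp₀.1 h0.symm
          have hc : cSigma p₀.1 p₀.2 σ = 0 := hp₀.2
          rw [hp0] at hc
          exact cSigma_xi0_ne_zero σ hc
      · have hpZ : p ∈ Z := ⟨hp, h0⟩
        exact absurd ((isMinOn_iff.mp hmin) p hpZ) (not_le.mpr hlt)
    · exact ⟨1, one_pos, fun p hp _ h0 => hZne ⟨p, hp, h0⟩⟩
  choose δσ hδpos hδ using key
  set δm := (Finset.univ : Finset (Fin 3 → ℤˣ)).inf' Finset.univ_nonempty δσ with hδm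
  have hδm_pos : 0 < δm := (Finset.lt_inf'_iff _).mpr fun σ _ => hδpos σ
  have hδm_le : ∀ σ, δm ≤ δσ σ := fun σ => Finset.inf'_le _ (Finset.mem_univ σ)
  refine ⟨min (1 / 2) (δm / 4), lt_min (by norm_num) (by linarith), fun η n hη hn1 hn hnN σ => ?_⟩
  have hp : (η, n) ∈ K := ⟨fun j => (hη j).trans (min_le_left _ _), hn1, hn, hnN⟩
  have hdp : d (η, n) < δσ σ :=
    calc d (η, n) = ∑ j, ‖η j - xi0 j‖ := rfl
      _ ≤ ∑ _j : Fin 3, min (1 / 2) (δm / 4) := Finset.sum_le_sum fun j _ => hη j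
      _ = 3 * min (1 / 2) (δm / 4) := by simp
      _ < δm := by linarith [min_le_right (1 / 2 : ℝ) (δm / 4)]
      _ ≤ δσ σ := hδm_le σ
  exact hδ σ (η, n) hp hdp


/-! ### Fourier inversion on `(ℝ/2πℤ)³`: the representation (3.23) ("bigmess-6") -/

/-- Orthogonality of characters on `[0, 2π]`: `∫₀^{2π} e^{ikθ} dθ = 2π [k = 0]` for `k ∈ ℤ`. [folklore] -/
theorem intervalIntegral_exp_I_intCast_mul (k : ℤ) :
    ∫ θ in (0 : ℝ)..2 * π, Complex.exp (Complex.I * (k : ℂ) * (θ : ℂ)) =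
      if k = 0 then 2 * (π : ℂ) else 0 := by
  split_ifs with hk
  · simp [hk]
  · have hc : Complex.I * (k : ℂ) ≠ 0 := mul_ne_zero Complex.I_ne_zero (Int.cast_ne_zero.mpr hk)
    have h := integral_exp_mul_complex (a := 0) (b := 2 * π) hc
    simp only [mul_assoc] at h ⊢
    rw [h]
    have h1 : Complex.I * ((k : ℂ) * ((2 * π : ℝ) : ℂ)) = (k : ℂ) * (2 * π * Complex.I) := by
      push_cast; ring
    rw [h1, Complex.exp_int_mul_two_pi_mul_I]
    simp

/-- The same on the set `(0, 2π]`. [folklore] -/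
theorem setIntegral_Ioc_exp_I_intCast_mul (k : ℤ) :
    ∫ θ in Set.Ioc (0 : ℝ) (2 * π), Complex.exp (Complex.I * (k : ℂ) * (θ : ℂ)) =
      if k = 0 then 2 * (π : ℂ) else 0 := by
  rw [← intervalIntegral.integral_of_le (by positivity : (0 : ℝ) ≤ 2 * π)]
  exact intervalIntegral_exp_I_intCast_mul k

/-- **Fourier inversion on `(ℝ/2πℤ)³` — the representation (3.23)** (Tao 2016, §3.8 "bigmess-6"
and §3.9: "From the Fourier inversion formula on `(ℝ/2πℤ)³`, we thus obtain (3.23) as long as we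
have the non-degeneracy condition (3.24)"): whenever `c_σ(η) ≠ 0`,
`e^{i(σ₁α₁+σ₂α₂+σ₃α₃)} = ∫_{(0,2π]³} F_σ(θ) Θ_η(θ + α) dθ` for all `α`, with the smooth weight
`F_σ(θ) = e^{-i(σ₁θ₁+σ₂θ₂+σ₃θ₃)} / ((2π)³ c_σ(η))`. [cite: Tao2016AveragedNS, §3.8–3.9 (3.23)–(3.24) pp. 19–20] -/
theorem exp_eq_integral_thetaFn {η : Fin 3 → ℝ³} {n : ℝ³} (hn1 : ‖n‖ = 1) (hn : ∀ j, ⟪n, η j⟫ = 0)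
    (σ : Fin 3 → ℤˣ) (hc : cSigma η n σ ≠ 0) (α : Fin 3 → ℝ) :
    Complex.exp (Complex.I * ∑ j, ((σ j : ℤ) : ℂ) * (α j : ℂ)) =
      ∫ θ in Set.pi Set.univ (fun _ : Fin 3 => Set.Ioc (0 : ℝ) (2 * π)),
        (cSigma η n σ)⁻¹ / (2 * π) ^ 3 * Complex.exp (-(Complex.I * ∑ j, ((σ j : ℤ) : ℂ) * (θ j : ℂ))) *
          (thetaFn η n (θ + α) : ℂ) := by
  -- the characters `θ ↦ e^{i(τⱼ-σⱼ)θⱼ}` and the coefficients in front of them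
  set g : (Fin 3 → ℤˣ) → Fin 3 → ℝ → ℂ := fun τ j x =>
    Complex.exp (Complex.I * (((τ j : ℤ) - (σ j : ℤ) : ℤ) : ℂ) * (x : ℂ)) with hg
  set A : (Fin 3 → ℤˣ) → ℂ := fun τ => (cSigma η n σ)⁻¹ / (2 * π) ^ 3 * cSigma η n τ *
      Complex.exp (Complex.I * ∑ j, ((τ j : ℤ) : ℂ) * (α j : ℂ)) with hA
  -- Step 1: expand the integrand
  have hpt : ∀ θ : Fin 3 → ℝ,
      (cSigma η n σ)⁻¹ / (2 * π) ^ 3 * Complex.exp (-(Complex.I * ∑ j, ((σ j : ℤ) : ℂ) * (θ j : ℂ))) *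
          (thetaFn η n (θ + α) : ℂ) = ∑ τ : Fin 3 → ℤˣ, A τ * ∏ j, g τ j (θ j) := by
    intro θ
    rw [thetaFn_eq_sum_cSigma hn1 hn, Finset.mul_sum]
    refine Finset.sum_congr rfl fun τ _ => ?_
    simp only [hA, hg, Fin.sum_univ_three, Fin.prod_univ_three, Pi.add_apply, Complex.ofReal_add]
    push_cast
    simp only [mul_add, add_mul, mul_neg, neg_mul, neg_add, sub_eq_add_neg, Complex.exp_add, Complex.exp_neg]
    field_simp
  simp_rw [hpt]
  -- Step 2: integrate term by term
  have hcont : ∀ τ, Continuous fun θ : Fin 3 → ℝ => A τ * ∏ j, g τ j (θ j) := by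
    intro τ
    refine continuous_const.mul (continuous_finsetProd _ fun j _ => ?_)
    simp only [hg]
    fun_prop
  have hint : ∀ τ, IntegrableOn (fun θ : Fin 3 → ℝ => A τ * ∏ j, g τ j (θ j))
      (Set.pi Set.univ fun _ : Fin 3 => Set.Ioc (0 : ℝ) (2 * π)) volume := by
    intro τ
    refine IntegrableOn.mono_set ?_ (Set.pi_mono fun _ _ => Set.Ioc_subset_Icc_self)
    exact (hcont τ).continuousOn.integrableOn_compact (isCompact_univ_pi fun _ => isCompact_Icc)
  rw [integral_finsetSum _ fun τ _ => hint τ]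
  -- Step 3: each term factorises over the three angles
  have hprod : ∀ τ, ∫ θ in Set.pi Set.univ (fun _ : Fin 3 => Set.Ioc (0 : ℝ) (2 * π)),
      A τ * ∏ j, g τ j (θ j) = A τ * ∏ j, ∫ x in Set.Ioc (0 : ℝ) (2 * π), g τ j x := by
    intro τ
    rw [integral_const_mul]
    congr 1
    rw [show (volume : Measure (Fin 3 → ℝ)).restrict (Set.pi Set.univ fun _ : Fin 3 => Set.Ioc (0 : ℝ) (2 * π)) =
        Measure.pi fun _ : Fin 3 => (volume : Measure ℝ).restrict (Set.Ioc (0 : ℝ) (2 * π)) by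
      rw [volume_pi, Measure.restrict_pi_pi]]
    exact integral_fintype_prod_eq_prod (fun j x => g τ j x)
  simp_rw [hprod]
  -- Step 4: orthogonality
  have h1d : ∀ τ j, ∫ x in Set.Ioc (0 : ℝ) (2 * π), g τ j x =
      if τ j = σ j then 2 * (π : ℂ) else 0 := by
    intro τ j
    simp only [hg]
    rw [setIntegral_Ioc_exp_I_intCast_mul]
    simp only [sub_eq_zero, Units.val_inj]
  simp_rw [h1d]
  have hsel : ∀ τ : Fin 3 → ℤˣ, (∏ j, if τ j = σ j then 2 * (π : ℂ) else 0) =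
      if τ = σ then (2 * (π : ℂ)) ^ 3 else 0 := by
    intro τ
    split_ifs with h
    · simp [h]
    · obtain ⟨j, hj⟩ := Function.ne_iff.mp h
      exact Finset.prod_eq_zero (Finset.mem_univ j) (if_neg hj)
  simp_rw [hsel, mul_ite, mul_zero, Finset.sum_ite_eq', Finset.mem_univ, if_true]
  -- Step 5: the surviving term
  simp only [hA]
  have hπ : (π : ℂ) ≠ 0 := Complex.ofReal_ne_zero.mpr Real.pi_ne_zero
  field_simp

end Literature.Analysis.FluidPDE.Tao2016
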